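/- Free-seat work of EXTRA WIDTH SEAT `ym-line-cbag-p1-w4` (prover-ym-line-cbag-p1-w4-g2-0), route `EguchiKawaiDirectionLadder`
(ideator ym-idea-2, LINE 8), crux `TripleSmallBallMargin` (stmt-QuantumFields-27724): the LABEL-LANGUAGE form of S10-A (LEAD's
`…CompressionSplitGeneral`, p643277): compression split of a block of ANY unitary with the LINEAR far mass, in the shape consumed by the
S9 decoupling files (`…BlockFibreBound`, `…BlockDecoupling`).  ROUTE-INDEPENDENT.  Nothing here bears on the Yang–Mills mass gap. -/
import Summits.QuantumFields.YangMills.Theorems.EguchiKawaiDirectionLadderCompressionSplitGeneral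
import HarnessLib

/-!
# Route `EguchiKawaiDirectionLadder`: compression split in the label language, linear far mass

`compression_split_labels_linear` — for `X ∈ U(N)`, a labelling `ℓ : Fin N → Fin m`, a block `c` and a collar set `near` of labels:
`X_{cc} = Θ + R + S` with `Θ` unitary, `rank R ≤ Σ_{a∈near} #{ℓ=a}` and the LINEAR far bound `Σ|S_{ij}|² ≤ Σ_{a ≠ c, a ∉ near} Σ|X_{ca}|²`.
Proof: the defect identity `1 − X_{cc}X_{cc}† = Σ_{a≠c} X_{ca}X_{ca}†` (`one_sub_compression_gram_eq_sum`) split into near (rank) and far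
(`0 ≤ D₂ ≤ 1`, so `‖D₂‖_F² ≤ tr D₂` = far mass, LEAD's `sum_norm_sq_le_re_trace_of_posSemidef_le_one`) parts, then the LEAD's
`exists_unitary_add_lowRank_add_small_general` (general polar decomposition, no invertibility).

HONEST FRAMING: linear algebra only.  The route bears on the barrier-ledger fact `EguchiKawaiBreakdown` only.
-/

set_option autoImplicit false

noncomputable section

open scoped Matrix ComplexOrder
open Literature.Barriers.QuantumFields

namespace Summit.QuantumFields.YangMills.Theorems.EguchiKawaiDirectionLadder

/-! ### The compression split in the label language with the linear far mass -/

section Labels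

variable {N m : ℕ}

/-- **Compression split, LINEAR far mass (S10-A).**  For `X ∈ U(N)`, a labelling `ℓ`, a block `c` and a collar set `near`:
`X_{cc} = Θ + R + S`, `Θ` unitary, `rank R ≤ Σ_{a∈near}#{ℓ=a}`, `Σ|S|² ≤ Σ_{a ≠ c, a ∉ near} Σ|X_{ca}|²`. -/
theorem compression_split_labels_linear (ℓ : Fin N → Fin m) (X : UN N) (c : Fin m) (near : Finset (Fin m)) :
    ∃ Θ R S : Matrix {i : Fin N // ℓ i = c} {i : Fin N // ℓ i = c} ℂ,
      Θ ∈ Matrix.unitaryGroup {i : Fin N // ℓ i = c} ℂ ∧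
      R.rank ≤ ∑ a ∈ near, Fintype.card {i : Fin N // ℓ i = a} ∧
      ∑ i, ∑ j, ‖S i j‖ ^ 2 ≤ ∑ a ∈ (Finset.univ.erase c).filter (fun a => a ∉ near),
        ∑ i, ∑ j, ‖(X : Matrix (Fin N) (Fin N) ℂ).toBlock (fun i => ℓ i = c) (fun i => ℓ i = a) i j‖ ^ 2 ∧
      (X : Matrix (Fin N) (Fin N) ℂ).toBlock (fun i => ℓ i = c) (fun i => ℓ i = c) = Θ + R + S := by
  classical
  set O : Finset (Fin m) := Finset.univ.erase c with hO
  set G : Fin m → Matrix {i : Fin N // ℓ i = c} {i : Fin N // ℓ i = c} ℂ := fun a =>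
    (X : Matrix (Fin N) (Fin N) ℂ).toBlock (fun i => ℓ i = c) (fun i => ℓ i = a) *
      ((X : Matrix (Fin N) (Fin N) ℂ).toBlock (fun i => ℓ i = c) (fun i => ℓ i = a))ᴴ with hG
  have hGpsd : ∀ a, (G a).PosSemidef := fun a => Matrix.posSemidef_self_mul_conjTranspose _
  set D₁ := ∑ a ∈ O.filter (fun a => a ∈ near), G a with hD₁
  set D₂ := ∑ a ∈ O.filter (fun a => a ∉ near), G a with hD₂
  have hsplit : 1 - (X : Matrix (Fin N) (Fin N) ℂ).toBlock (fun i => ℓ i = c) (fun i => ℓ i = c) *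
      ((X : Matrix (Fin N) (Fin N) ℂ).toBlock (fun i => ℓ i = c) (fun i => ℓ i = c))ᴴ = D₁ + D₂ := by
    rw [one_sub_compression_gram_eq_sum X ℓ c, hD₁, hD₂]
    exact (Finset.sum_filter_add_sum_filter_not O (fun a => a ∈ near) G).symm
  obtain ⟨Θ, R, S, hΘ, hR, hS, hXeq⟩ := exists_unitary_add_lowRank_add_small_general _ D₁ D₂ hsplit
  refine ⟨Θ, R, S, hΘ, hR.trans ?_, hS.trans ?_, hXeq⟩
  · calc D₁.rank ≤ ∑ a ∈ O.filter (fun a => a ∈ near), (G a).rank := rank_sum_le _ _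
      _ ≤ ∑ a ∈ O.filter (fun a => a ∈ near), Fintype.card {i : Fin N // ℓ i = a} :=
          Finset.sum_le_sum fun a _ => rank_mul_conjTranspose_le_card _
      _ ≤ ∑ a ∈ near, Fintype.card {i : Fin N // ℓ i = a} :=
          Finset.sum_le_sum_of_subset fun a ha => (Finset.mem_filter.1 ha).2
  · -- `0 ≤ D₂ ≤ 1`, hence `Σ|D₂|² ≤ tr D₂ = far mass`
    have hD₂psd : D₂.PosSemidef := by
      rw [hD₂]
      exact Matrix.posSemidef_sum _ fun a _ => hGpsd a
    have h1D₂ : (1 - D₂).PosSemidef := by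
      -- `1 − D₂ = X_cc X_cc† + D₁`, a sum of positive semidefinite matrices
      have h : 1 - D₂ = (X : Matrix (Fin N) (Fin N) ℂ).toBlock (fun i => ℓ i = c) (fun i => ℓ i = c) *
          ((X : Matrix (Fin N) (Fin N) ℂ).toBlock (fun i => ℓ i = c) (fun i => ℓ i = c))ᴴ + D₁ := by
        -- from `1 − M M† = D₁ + D₂`: `1 − D₂ = M M† + D₁`
        calc (1 : Matrix {i : Fin N // ℓ i = c} {i : Fin N // ℓ i = c} ℂ) - D₂
            = (1 - (X : Matrix (Fin N) (Fin N) ℂ).toBlock (fun i => ℓ i = c) (fun i => ℓ i = c) *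
                ((X : Matrix (Fin N) (Fin N) ℂ).toBlock (fun i => ℓ i = c) (fun i => ℓ i = c))ᴴ) +
              (X : Matrix (Fin N) (Fin N) ℂ).toBlock (fun i => ℓ i = c) (fun i => ℓ i = c) *
                ((X : Matrix (Fin N) (Fin N) ℂ).toBlock (fun i => ℓ i = c) (fun i => ℓ i = c))ᴴ - D₂ := by abel
          _ = (D₁ + D₂) + (X : Matrix (Fin N) (Fin N) ℂ).toBlock (fun i => ℓ i = c) (fun i => ℓ i = c) *
                ((X : Matrix (Fin N) (Fin N) ℂ).toBlock (fun i => ℓ i = c) (fun i => ℓ i = c))ᴴ - D₂ := by rw [hsplit]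
          _ = _ := by abel
      rw [h]
      refine (Matrix.posSemidef_self_mul_conjTranspose _).add ?_
      rw [hD₁]
      exact Matrix.posSemidef_sum _ fun a _ => hGpsd a
    have hle := sum_norm_sq_le_re_trace_of_posSemidef_le_one hD₂psd h1D₂
    have htr : (Matrix.trace D₂).re = ∑ a ∈ O.filter (fun a => a ∉ near),
        ∑ i, ∑ j, ‖(X : Matrix (Fin N) (Fin N) ℂ).toBlock (fun i => ℓ i = c) (fun i => ℓ i = a) i j‖ ^ 2 := by
      rw [hD₂, Matrix.trace_sum, Complex.re_sum]
      refine Finset.sum_congr rfl fun a _ => ?_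
      exact re_trace_mul_conjTranspose_eq_sum _
    rw [htr] at hle
    exact hle

end Labels

end Summit.QuantumFields.YangMills.Theorems.EguchiKawaiDirectionLadder

end
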